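import Summits.BirchSwinnertonDyer.BirchSwinnertonDyer.Theorems.SignedBaseChangeAnticyclotomicEisensteinDivisibilityControlCoker
import Summits.BirchSwinnertonDyer.BirchSwinnertonDyer.Theorems.SignedBaseChangeAnticyclotomicEisensteinDivisibilityTorsionLift
import Summits.BirchSwinnertonDyer.BirchSwinnertonDyer.Theorems.SignedBaseChangeAnticyclotomicEisensteinDivisibilityXGrTwoModuleFinite
import Mathlib.Algebra.Module.CharacterModule
import HarnessLib

/-!
# Torsion transfer through control: `X_Gr(E/K̃_∞)` is `Λ₂`-torsion as soon as `X_ac` is `Λ`-torsion and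
# the LOCAL discrepancy between "Greenberg over `K̃_∞`" and Castella's conditions over `K_∞⁻` is
# `Λ`-cotorsion (helper for crux `AnticyclotomicEisensteinDivisibility`, stmt-BirchSwinnertonDyer-20727,
# line `bdpline` v8, stub `stub_torsionSS`)

Width seat bsd-line-sbc-p1-w2 gen 2 (2026-08-28). The registered stub `stub_torsionSS` of line `bdpline`
asks for `Module.IsTorsion Λ₂ X_Gr₂`, `X_Gr₂ = Hom(H¹_{nr,v̄}(K̃_∞, E[p^∞]), ℚ/ℤ)` (two variables, good
supersingular `p`, additive conductor — not in print). The census of record (census-20727-gen0.md,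
roadmap (i)–(iii)) reduces it to ONE-variable anticyclotomic data through the control map
`toXAc : X_Gr₂ → X_ac = Hom(Sel_v̄(K_∞⁻, E[p^∞]), ℚ/ℤ)` (`x ↦ x ∘ res`, tree p561609) and the rank lemma
of `…TorsionLift.lean` (p553279); with finite generation now a tree theorem
(`SignedBaseChangeAcDivFinitePiece.xGr₂_module_finite`, p610206) and the cokernel half of control landed
(`…ControlCoker.lean`), this file assembles the reduction:

* §1 `mem_X_smul_top_of_forall_apply_eq_zero`: a character of `S = H¹_{nr,v̄}(K̃_∞, E[p^∞])` vanishing on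
  the `γ₁`-invariants `S[γ₁ − 1]` lies in `T₁ · X_Gr₂` (it factors through `S/S[γ₁−1] ≅ (γ₁ − 1)S ⊆ S`
  and extends to `S` by divisibility of `ℚ/ℤ`, `CharacterModule.dual_surjective_of_injective`); with the
  converse `apply_eq_zero_of_mem_X_smul_top`: **`T₁ X_Gr₂ = Ann(S[γ₁ − 1])`**.
* §2 `xGr₂_isTorsion_of_isTorsion_XAc_of_ker` (pure algebra over the tree's carriers): if `X_Gr₂` is
  finitely generated, `X_ac` is `Λ`-torsion, and every `x ∈ ker (toXAc)` has a non-zero `g ∈ Λ = ℤ_p⟦T₂⟧`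
  with `C g · x ∈ T₁ X_Gr₂` ("the kernel of `X_Gr₂/T₁ ↠ X_ac` is `Λ`-torsion"), then `X_Gr₂` is
  `Λ₂`-torsion — the multiplier `C(g a) ∉ (T₁)` feeds `xGr₂_isTorsion_of_finite_of_forall`.
* §3 the kernel hypothesis UNFOLDED through the control isomorphism `S[γ₁ − 1] = res(res⁻¹ S)`
  (`SignedBaseChangeAcDivControlCoker.exists_resOfLe_eq_of_conjSel₂_eq`, under `E(K)[p] = 0`):
  `mem_X_smul_top_iff_forall_resOfLe` — `z ∈ T₁ X_Gr₂` iff `z` kills every `res a`, `a ∈ H¹(K_∞⁻, E[p^∞])`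
  with `res a` Greenberg over `K̃_∞`; hence the final form `xGr₂_isTorsion_of_isTorsion_XAc_of_local`:
  **`X_Gr₂` is `Λ₂`-torsion ⟸ `X_ac` is `Λ`-torsion ∧ every character of `S` vanishing on
  `res(Sel_v̄(K_∞⁻, E[p^∞]))` is killed, on `res(res⁻¹ S)`, by some non-zero `g(T₂)`** — i.e. the
  Pontryagin dual of the local discrepancy `Q = res⁻¹(H¹_{nr,v̄}(K̃_∞, E[p^∞])) / Sel_v̄(K_∞⁻, E[p^∞])`
  (classes over `K_∞⁻` that are unramified at `v̄` and away from `p` AFTER restriction to `K̃_∞`, modulo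
  those strict at `v̄` and trivial away from `p` over `K_∞⁻`) is `Λ`-torsion. What remains for
  `stub_torsionSS` is therefore one-variable: `X_ac` `Λ`-torsion (BDP/CGLS/Kobayashi–Ota currency) and the
  local statement on `Q` (places of `K_∞⁻` above `v̄`: finitely many + bounded corank; places `w ∤ p`:
  inertia unchanged in `K̃_∞/K_∞⁻`) — neither is claimed here.

Honest framing: algebra and bookkeeping on CONSTRUCTED carriers; no torsion, main conjecture or BSD
statement is asserted. References: C. Skinner, E. Urban, Invent. Math. 195 (2014), §3.2.7–Prop. 3.2.8
(p. 23); R. Greenberg, LNM 1716 (1999), §3; F. Castella, Camb. J. Math. 6 (2018), Def. 2.2; S. Lang,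
*Cyclotomic Fields I–II*, Ch. 5 §1 (Pontryagin duals as `Λ`-modules).
-/

-- D-0017: single-problem summit, the namespace repeats the problem name by design.
set_option linter.dupNamespace false
set_option autoImplicit false

noncomputable section

open scoped Classical

open Literature.NumberTheory.EllipticCurves Literature.NumberTheory.GaloisRepresentations
  Literature.NumberTheory.EllipticCurves.Castella2018

namespace Summit.BirchSwinnertonDyer.BirchSwinnertonDyer.Theorems.SignedBaseChangeAcDivControlTorsion

variable {K : Type} [Field K] [NumberField K] (W : WeierstrassCurve K) (p : ℕ) [Fact p.Prime]
  (κ₁ κ₂ : ZpExtension K p) (vbar : IsDedekindDomain.HeightOneSpectrum (NumberField.RingOfIntegers K))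
  (γ₁ γ₂ : Field.absoluteGaloisGroup K) [hγ : Fact (ZpExtension.IsTopGeneratorPair κ₁ κ₂ γ₁ γ₂)]

/-! ## §1 `T₁ · X_Gr₂ = Ann(S[γ₁ − 1])` (divisibility of `ℚ/ℤ`) -/

/-- **A character of `S = H¹_{nr,v̄}(K̃_∞, E[p^∞])` vanishing on `S[γ₁ − 1]` is a `T₁`-multiple.** If
`x(s) = 0` whenever `conj_{γ₁} s = s`, then `x ∈ (T₁) · X_Gr₂`: `x` factors through
`S / S[γ₁ − 1] ≅ (γ₁ − 1)S` (`AddMonoidHom.liftOfSurjective`), the induced character of `(γ₁ − 1)S ≤ S`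
extends to a character `y` of `S` (`ℚ/ℤ` is divisible: `CharacterModule.dual_surjective_of_injective`),
and `x = y ∘ (γ₁ − 1) = T₁ · y` (`XGr₂.X_smul_apply`). Lang, Ch. 5 §1. [cite: Lang1990, Ch. 5 §1] -/
theorem mem_X_smul_top_of_forall_apply_eq_zero (x : W.XGr₂ p κ₁ κ₂ vbar γ₁ γ₂)
    (hx : ∀ s : unrSelmer₂ κ₁ κ₂ (W.geomPrimaryTorsion p) vbar,
      conjSel₂ κ₁ κ₂ (W.geomPrimaryTorsion p) vbar γ₁ s = s → x s = 0) :
    x ∈ Ideal.span {(PowerSeries.X : IwasawaAlgebra₂ p)} •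
      (⊤ : Submodule (IwasawaAlgebra₂ p) (W.XGr₂ p κ₁ κ₂ vbar γ₁ γ₂)) := by
  -- `ψ = conj_{γ₁} − 1` on `S`
  let ψ : unrSelmer₂ κ₁ κ₂ (W.geomPrimaryTorsion p) vbar →+ unrSelmer₂ κ₁ κ₂ (W.geomPrimaryTorsion p) vbar :=
    (conjSel₂ κ₁ κ₂ (W.geomPrimaryTorsion p) vbar γ₁ - 1 :
      AddMonoid.End (unrSelmer₂ κ₁ κ₂ (W.geomPrimaryTorsion p) vbar))
  have hψ : ∀ s, ψ s = conjSel₂ κ₁ κ₂ (W.geomPrimaryTorsion p) vbar γ₁ s - s := fun s ↦ rfl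
  have hsurj := AddMonoidHom.rangeRestrict_surjective ψ
  -- `x` kills `ker ψ = S[γ₁ − 1]`, so it factors through `ψ.range`
  have hxker : ψ.rangeRestrict.ker ≤
      (x : unrSelmer₂ κ₁ κ₂ (W.geomPrimaryTorsion p) vbar →+ AddCircle (1 : ℚ)).ker := by
    intro s hs
    rw [AddMonoidHom.ker_rangeRestrict, AddMonoidHom.mem_ker, hψ, sub_eq_zero] at hs
    exact (AddMonoidHom.mem_ker).mpr (hx s hs)
  let xbar : ψ.range →+ AddCircle (1 : ℚ) := ψ.rangeRestrict.liftOfSurjective hsurj ⟨_, hxker⟩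
  have hxbar : ∀ s, xbar (ψ.rangeRestrict s) = x s := fun s ↦
    AddMonoidHom.liftOfRightInverse_comp_apply _ _ _ ⟨_, hxker⟩ s
  -- extend to all of `S` by divisibility of `ℚ/ℤ`
  obtain ⟨y, hy⟩ := CharacterModule.dual_surjective_of_injective ψ.range.subtype.toIntLinearMap
    Subtype.val_injective xbar
  have hy' : ∀ r : ψ.range, y (r : unrSelmer₂ κ₁ κ₂ (W.geomPrimaryTorsion p) vbar) = xbar r :=
    fun r ↦ DFunLike.congr_fun hy r
  -- `x = T₁ · y`
  let y' : W.XGr₂ p κ₁ κ₂ vbar γ₁ γ₂ := y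
  have hyy' : ∀ s, y' s = y s := fun _ ↦ rfl
  have hxy : x = (PowerSeries.X : IwasawaAlgebra₂ p) • y' := by
    refine DFunLike.ext _ _ fun s ↦ ?_
    rw [WeierstrassCurve.XGr₂.X_smul_apply, ← hxbar s, hyy', hyy']
    have e : (ψ.rangeRestrict s : unrSelmer₂ κ₁ κ₂ (W.geomPrimaryTorsion p) vbar) =
        conjSel₂ κ₁ κ₂ (W.geomPrimaryTorsion p) vbar γ₁ s - s := by
      rw [AddMonoidHom.coe_rangeRestrict, hψ]
    rw [← hy', e]
    exact map_sub y _ _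
  rw [hxy]
  exact Submodule.smul_mem_smul (Ideal.mem_span_singleton_self _) Submodule.mem_top

/-- Conversely, **`T₁ · X_Gr₂` kills `S[γ₁ − 1]`**: every `z ∈ (T₁) · X_Gr₂` vanishes on the classes
fixed by `conj_{γ₁}` (`(T₁ · m)(s) = m(conj_{γ₁} s) − m(s)`). [cite: Lang1990, Ch. 5 §1] -/
theorem apply_eq_zero_of_mem_X_smul_top {z : W.XGr₂ p κ₁ κ₂ vbar γ₁ γ₂}
    (hz : z ∈ Ideal.span {(PowerSeries.X : IwasawaAlgebra₂ p)} •
      (⊤ : Submodule (IwasawaAlgebra₂ p) (W.XGr₂ p κ₁ κ₂ vbar γ₁ γ₂)))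
    (s : unrSelmer₂ κ₁ κ₂ (W.geomPrimaryTorsion p) vbar)
    (hs : conjSel₂ κ₁ κ₂ (W.geomPrimaryTorsion p) vbar γ₁ s = s) : z s = 0 := by
  refine Submodule.smul_induction_on hz (fun r hr m _ ↦ ?_) (fun u v hu hv ↦ ?_)
  · obtain ⟨a, rfl⟩ := Ideal.mem_span_singleton'.mp hr
    rw [mul_comm, mul_smul, WeierstrassCurve.XGr₂.X_smul_apply, hs, sub_self]
  · change u s + v s = 0
    rw [hu, hv, add_zero]

/-! ## §2 Torsion transfer (algebra): `X_ac` torsion + torsion kernel of `X_Gr₂/T₁ ↠ X_ac` ⇒ `X_Gr₂` torsion -/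

/-- **`X_Gr(E/K̃_∞)` is `Λ₂`-torsion if `X_ac` is `Λ`-torsion and the kernel of control is `Λ`-torsion.**
For the tree's CONSTRUCTED `Λ₂`-module `X_Gr₂` (finitely generated) and control map `toXAc : X_Gr₂ → X_ac`
(`π`-semilinear, `π : T₁ ↦ 0`, `C f ↦ f`): if `X_ac` is `Λ`-torsion and every `x` with `toXAc x = 0` has
some `g ≠ 0` in `Λ = ℤ_p⟦T₂⟧` with `C g · x ∈ T₁ X_Gr₂`, then for each `x` a non-zero-divisor `a` kills
`toXAc x`, so `C a · x ∈ ker toXAc` (`toXAc_C_smul`), `C g · C a · x ∈ T₁ X_Gr₂`, and `C(g a) ∉ (T₁)`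
(`constantCoeff (C (g a)) = g a ≠ 0`, `Λ` a domain) is the multiplier asked by
`SignedBaseChangeAcDivTorsionLift.xGr₂_isTorsion_of_finite_of_forall` (determinant trick + `(T₁)` prime).
Greenberg's rank bookkeeping "X f.g., X/T₁X → X_ac with torsion kernel and torsion target ⇒ X torsion".
[cite: GreenbergLNM1716, §3 (control and ranks)] [cite: SkinnerUrban2014, Prop. 3.2.8 (p. 23)] -/
theorem xGr₂_isTorsion_of_isTorsion_XAc_of_ker [Fact (κ₂.IsTopGenerator γ₂)]
    [Module.Finite (IwasawaAlgebra₂ p) (W.XGr₂ p κ₁ κ₂ vbar γ₁ γ₂)]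
    (hac : Module.IsTorsion (IwasawaAlgebra p) (AcSelmer.XAc W p κ₂ vbar ∅ γ₂))
    (hker : ∀ x : W.XGr₂ p κ₁ κ₂ vbar γ₁ γ₂, WeierstrassCurve.XGr₂.toXAc W p κ₁ κ₂ vbar γ₁ γ₂ x = 0 →
      ∃ g : IwasawaAlgebra p, g ≠ 0 ∧ (PowerSeries.C g : IwasawaAlgebra₂ p) • x ∈
        Ideal.span {(PowerSeries.X : IwasawaAlgebra₂ p)} •
          (⊤ : Submodule (IwasawaAlgebra₂ p) (W.XGr₂ p κ₁ κ₂ vbar γ₁ γ₂))) :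
    Module.IsTorsion (IwasawaAlgebra₂ p) (W.XGr₂ p κ₁ κ₂ vbar γ₁ γ₂) := by
  refine SignedBaseChangeAcDivTorsionLift.xGr₂_isTorsion_of_finite_of_forall W p κ₁ κ₂ vbar γ₁ γ₂
    fun x ↦ ?_
  obtain ⟨⟨a, ha⟩, hax⟩ := @hac (WeierstrassCurve.XGr₂.toXAc W p κ₁ κ₂ vbar γ₁ γ₂ x)
  have ha0 : a ≠ 0 := nonZeroDivisors.ne_zero ha
  have hax' : a • WeierstrassCurve.XGr₂.toXAc W p κ₁ κ₂ vbar γ₁ γ₂ x = 0 := hax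
  have hx' : WeierstrassCurve.XGr₂.toXAc W p κ₁ κ₂ vbar γ₁ γ₂
      ((PowerSeries.C a : IwasawaAlgebra₂ p) • x) = 0 := by
    rw [WeierstrassCurve.XGr₂.toXAc_C_smul, hax']
  obtain ⟨g, hg0, hg⟩ := hker _ hx'
  refine ⟨PowerSeries.C g * PowerSeries.C a, ?_, ?_⟩
  · rw [Ideal.mem_span_singleton, ← map_mul, PowerSeries.X_dvd_iff, PowerSeries.constantCoeff_C]
    exact mul_ne_zero hg0 ha0
  · rw [mul_smul]
    exact hg

/-! ## §3 The kernel hypothesis through the control isomorphism `S[γ₁ − 1] = res(res⁻¹ S)` -/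

omit hγ in
/-- A restricted class `res a` (`a ∈ H¹(K_∞⁻, E[p^∞])`) lying in `S = H¹_{nr,v̄}(K̃_∞, E[p^∞])` is fixed by
`conj_{γ₁}` (`γ₁ ∈ Gal(K̄/K_∞⁻)` acts trivially upstairs and `res` is equivariant;
`SignedBaseChangeAcDivControlCoker.mem_range_resOfLe_iff_conjH1_eq`). [cite: SkinnerUrban2014, §3.2.7 (p. 23)] -/
theorem conjSel₂_resOfLe_eq [W.IsElliptic] (hpair : ZpExtension.IsTopGeneratorPair κ₁ κ₂ γ₁ γ₂)
    (hK : ∀ P : W.toAffine.Point, p • P = 0 → P = 0)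
    (a : W.subgroupH1 p κ₂.kerSubgroup)
    (ha : W.resOfLe p (ZpExtension.pairKer_le_right κ₁ κ₂) a ∈ unrSelmer₂ κ₁ κ₂ (W.geomPrimaryTorsion p) vbar) :
    conjSel₂ κ₁ κ₂ (W.geomPrimaryTorsion p) vbar γ₁ ⟨_, ha⟩ = ⟨_, ha⟩ :=
  Subtype.ext (by
    rw [coe_conjSel₂_apply]
    exact (SignedBaseChangeAcDivControlCoker.mem_range_resOfLe_iff_conjH1_eq W hpair hK _).mp ⟨a, rfl⟩)

/-- **`z ∈ T₁ X_Gr₂` iff `z` kills `res(res⁻¹ S)`** (under `E(K)[p] = 0`): the `γ₁`-invariants of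
`S = H¹_{nr,v̄}(K̃_∞, E[p^∞])` are exactly the restrictions of the classes of `H¹(K_∞⁻, E[p^∞])` whose
restriction is Greenberg over `K̃_∞` (`…ControlCoker.exists_resOfLe_eq_of_conjSel₂_eq` + §1).
[cite: SkinnerUrban2014, Prop. 3.2.8 (p. 23)] [cite: Lang1990, Ch. 5 §1] -/
theorem mem_X_smul_top_iff_forall_resOfLe [W.IsElliptic] (hK : ∀ P : W.toAffine.Point, p • P = 0 → P = 0)
    (z : W.XGr₂ p κ₁ κ₂ vbar γ₁ γ₂) :
    z ∈ Ideal.span {(PowerSeries.X : IwasawaAlgebra₂ p)} •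
        (⊤ : Submodule (IwasawaAlgebra₂ p) (W.XGr₂ p κ₁ κ₂ vbar γ₁ γ₂)) ↔
      ∀ (a : W.subgroupH1 p κ₂.kerSubgroup)
        (ha : W.resOfLe p (ZpExtension.pairKer_le_right κ₁ κ₂) a ∈
          unrSelmer₂ κ₁ κ₂ (W.geomPrimaryTorsion p) vbar), z ⟨_, ha⟩ = 0 := by
  constructor
  · intro hz a ha
    exact apply_eq_zero_of_mem_X_smul_top W p κ₁ κ₂ vbar γ₁ γ₂ hz _
      (conjSel₂_resOfLe_eq W p κ₁ κ₂ vbar γ₁ γ₂ hγ.out hK a ha)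
  · intro h
    refine mem_X_smul_top_of_forall_apply_eq_zero W p κ₁ κ₂ vbar γ₁ γ₂ z fun s hs ↦ ?_
    obtain ⟨a, ha⟩ := SignedBaseChangeAcDivControlCoker.exists_resOfLe_eq_of_conjSel₂_eq W hγ.out hK vbar s hs
    have ha' : W.resOfLe p (ZpExtension.pairKer_le_right κ₁ κ₂) a ∈
        unrSelmer₂ κ₁ κ₂ (W.geomPrimaryTorsion p) vbar := by
      rw [ha]
      exact s.2
    have e : (⟨_, ha'⟩ : unrSelmer₂ κ₁ κ₂ (W.geomPrimaryTorsion p) vbar) = s := Subtype.ext ha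
    rw [← e]
    exact h a ha'

/-- `toXAc x = 0` iff the character `x` of `S` vanishes on `res(Sel_v̄(K_∞⁻, E[p^∞]))` (`toXAc x = x ∘ res`).
[cite: SkinnerUrban2014, §3.2.7 (p. 23)] -/
theorem toXAc_eq_zero_iff [Fact (κ₂.IsTopGenerator γ₂)] (x : W.XGr₂ p κ₁ κ₂ vbar γ₁ γ₂) :
    WeierstrassCurve.XGr₂.toXAc W p κ₁ κ₂ vbar γ₁ γ₂ x = 0 ↔
      ∀ s : AcSelmer.selmerAc W p κ₂ vbar ∅, x (W.selmerAcToUnrSelmer₂ p κ₁ κ₂ vbar s) = 0 := by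
  constructor
  · intro h s
    rw [← WeierstrassCurve.XGr₂.toXAc_apply, h]
    rfl
  · intro h
    exact DFunLike.ext _ _ fun s ↦ (WeierstrassCurve.XGr₂.toXAc_apply W p κ₁ κ₂ vbar γ₁ γ₂ x s).trans (h s)

/-- **Reduction of `stub_torsionSS` to one-variable anticyclotomic data.** For an elliptic curve `W`
over a number field `K`, a prime `p` with `E(K)[p] = 0`, `ℤ_p`-extensions `κ₁, κ₂` with a topological
generator pair `(γ₁, γ₂)` and a prime `v̄`: **`X_Gr(E/K̃_∞)` is `Λ₂`-torsion** provided
(a) Castella's `X_ac = Hom(Sel_v̄(K_∞⁻, E[p^∞]), ℚ/ℤ)` is `Λ`-torsion, and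
(b) (LOCAL DISCREPANCY, Pontryagin-dual form) every character `x` of `S = H¹_{nr,v̄}(K̃_∞, E[p^∞])` that
vanishes on `res(Sel_v̄(K_∞⁻, E[p^∞]))` is killed by some `g ≠ 0` in `Λ = ℤ_p⟦T₂⟧` on `res(res⁻¹ S)`
— i.e. the dual of `Q = res⁻¹(S)/Sel_v̄(K_∞⁻)` (classes over `K_∞⁻` that become unramified at `v̄` and
away from `p` over `K̃_∞`, modulo the strict/trivial ones) is `Λ`-torsion. Finite generation of `X_Gr₂`
is the tree theorem `SignedBaseChangeAcDivFinitePiece.xGr₂_module_finite` (p610206); then §2 + §3.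
Inputs (a), (b) are NOT proved here. [cite: GreenbergLNM1716, §3 (control and ranks)]
[cite: SkinnerUrban2014, Prop. 3.2.8 (p. 23)] [cite: Castella2018, Def. 2.2 (arXiv:1704.06608 p. 5)] -/
theorem xGr₂_isTorsion_of_isTorsion_XAc_of_local [W.IsElliptic] [Fact (κ₂.IsTopGenerator γ₂)]
    (hK : ∀ P : W.toAffine.Point, p • P = 0 → P = 0)
    (hac : Module.IsTorsion (IwasawaAlgebra p) (AcSelmer.XAc W p κ₂ vbar ∅ γ₂))
    (hQ : ∀ x : W.XGr₂ p κ₁ κ₂ vbar γ₁ γ₂,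
      (∀ s : AcSelmer.selmerAc W p κ₂ vbar ∅, x (W.selmerAcToUnrSelmer₂ p κ₁ κ₂ vbar s) = 0) →
        ∃ g : IwasawaAlgebra p, g ≠ 0 ∧ ∀ (a : W.subgroupH1 p κ₂.kerSubgroup)
          (ha : W.resOfLe p (ZpExtension.pairKer_le_right κ₁ κ₂) a ∈
            unrSelmer₂ κ₁ κ₂ (W.geomPrimaryTorsion p) vbar),
          ((PowerSeries.C g : IwasawaAlgebra₂ p) • x) ⟨_, ha⟩ = 0) :
    Module.IsTorsion (IwasawaAlgebra₂ p) (W.XGr₂ p κ₁ κ₂ vbar γ₁ γ₂) := by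
  haveI : Module.Finite (IwasawaAlgebra₂ p) (W.XGr₂ p κ₁ κ₂ vbar γ₁ γ₂) :=
    SignedBaseChangeAcDivFinitePiece.xGr₂_module_finite W p κ₁ κ₂ vbar
  refine xGr₂_isTorsion_of_isTorsion_XAc_of_ker W p κ₁ κ₂ vbar γ₁ γ₂ hac fun x hx ↦ ?_
  obtain ⟨g, hg0, hg⟩ := hQ x ((toXAc_eq_zero_iff W p κ₁ κ₂ vbar γ₁ γ₂ x).mp hx)
  exact ⟨g, hg0, (mem_X_smul_top_iff_forall_resOfLe W p κ₁ κ₂ vbar γ₁ γ₂ hK _).mpr hg⟩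

end Summit.BirchSwinnertonDyer.BirchSwinnertonDyer.Theorems.SignedBaseChangeAcDivControlTorsion

end
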